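import Summits.BirchSwinnertonDyer.Rank1Residual.X10.UnitRoad
import Literature.NumberTheory.EllipticCurves.BSDRankZeroDensityProofs
import Literature.NumberTheory.EllipticCurves.BSDSelmerCMPConverseRankOneProofs
import Literature.NumberTheory.EllipticCurves.LeadingTermPPartProofs
import Literature.NumberTheory.EllipticCurves.MordellWeilRankZeroProofs
import HarnessLib

/-!
# Class X10b (N2), the UNIT ROAD: the Selmer binder in the LANE'S certificate vocabulary —
# `#Sel^{(3)}(E/ℚ) = 1` (a full `3`-descent line) suffices (cell `b2b-bsdres`, unit `b2b-bsdres-x10`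
# = N2 class lead, gen 24)

HONEST FRAMING (run/shared/lean/b2b/bsd-rank1-residual/, verbatim in every file): the goal of the
cell is to DELETE the COMBINATION-SHAPED residual classes of the Birch–Swinnerton-Dyer formula for
ALL analytic-rank `≤ 1` elliptic curves over `ℚ` — "full BSD formula for every rank `≤ 1` curve in
class `C`" assembled STRICTLY from published theorems — so that the rank-`≤ 1` remainder becomes
exactly the CONSTRUCTION-SHAPED classes, which are TYPED (missing-input `Prop`s), NOT attempted.
This is not "finishing BSD". TOOL theorems only; no definition, no named fact; nothing booked.

## What

The unit / trivial-partner records (`X10/UnitRoadRecords*.lean`, `X10/UnitRoadPartnerRecords*.lean`,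
x10 GEN 24) display the binder `hSel : #Sel_{3^∞}(E/ℚ) = 1` (the shape of x9's route U2 and of
n1011's control tool). The lane's `3`-descent certificates (x10b `desc3ns` / `desc3full`, cc-eng-4
`SEL3CT@3`) certify `dim_{𝔽₃} Sel^{(3)}(E/ℚ) = 0`, i.e. `#Sel^{(3)}(E/ℚ) = 1`. This file proves the
bridge IN THE TREE, for any elliptic `W/ℚ` and any prime `p`:
`#Sel^{(p)}(E/ℚ) = 1 ⟹ #Sel_{p^∞}(E/ℚ) = 1` (`natCard_selmerGroupPInfty_eq_one_of_natCard_selmerGroup_eq_one`: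
the exact descent count `#Sel^{(p)} = p^{rank}·#E(ℚ)[p]·#Ш[p]` (Silverman X.4.2, tree
`natCard_selmerGroup_eq`) forces rank `0`, hence `E(ℚ)` finite, and `Ш[p] = 0`, hence `Ш[p^∞] = 0`,
and `#Sel_{p^∞} = #Ш[p^∞]` in rank `0`, tree `natCard_selmerGroupPInfty_eq_natCard_primaryComponent_sha`),
and restates the two short-form consumers of `X10/UnitRoad.lean` with `hSel3 : #Sel^{(3)}(E/ℚ) = 1`
(`…_of_card_selmerThree`). No rank hypothesis and no GZK are needed: `#Sel^{(3)} = 1` alone forces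
rank `0`. Axioms standard.

References: J. H. Silverman, *AEC* (2009) Thm. X.4.2 [SilvermanAEC2009]; R. Greenberg, LNM 1716
(1999) §1 p. 54 [GreenbergLNM1716].
-/

set_option autoImplicit false

noncomputable section

open scoped Classical MatrixGroups ModularForm

open CongruenceSubgroup WeierstrassCurve Literature.NumberTheory.EllipticCurves
  Literature.NumberTheory.EllipticCurves.ModularForms Literature.NumberTheory.EllipticCurves.Rank1Residual
  Literature.NumberTheory.EllipticCurves.Rank1Residual.X11RankOneCertificates
  Summit.BirchSwinnertonDyer.BirchSwinnertonDyer.Rank1Residual.IntModel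
  Summit.BirchSwinnertonDyer.BirchSwinnertonDyer.Rank1Residual.X11RankOne
  Summit.BirchSwinnertonDyer.BirchSwinnertonDyer.Theorems.Rank1ResidualX1Defs

namespace Summit.BirchSwinnertonDyer.Rank1Residual.X10.UnitRoad

/-- **`#Sel^{(p)}(E/ℚ) = 1 ⟹ #Sel_{p^∞}(E/ℚ) = 1`** for an elliptic `W/ℚ` and a prime `p`: by the
exact descent count `#Sel^{(p)} = p^{rank E(ℚ)} · #E(ℚ)[p] · #Ш(E/ℚ)[p]` (Silverman X.4.2) the rank
is `0` (so `E(ℚ)` is finite) and `Ш[p] = 0`, so `Ш[p^∞] = 0` and `#Sel_{p^∞}(E/ℚ) = #Ш[p^∞] = 1`.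
[cite: SilvermanAEC2009, Thm X.4.2] [cite: GreenbergLNM1716, §1 p. 54 and §2 p. 63] -/
theorem natCard_selmerGroupPInfty_eq_one_of_natCard_selmerGroup_eq_one
    (W : WeierstrassCurve ℚ) [W.IsElliptic] (p : ℕ) [Fact p.Prime]
    (h : Nat.card (W.selmerGroup p) = 1) : Nat.card (W.selmerGroupPInfty p) = 1 := by
  have hp : p.Prime := Fact.out
  have hcard := W.natCard_selmerGroup_eq hp.ne_zero
  rw [h] at hcard
  have h12 := Nat.eq_one_of_mul_eq_one_right hcard.symm
  have h3 := Nat.eq_one_of_mul_eq_one_left hcard.symm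
  have h1 := Nat.eq_one_of_mul_eq_one_right h12
  have hr : W.mordellWeilRank = 0 := by
    rcases Nat.pow_eq_one.mp h1 with h | h
    · exact absurd h hp.one_lt.ne'
    · exact h
  haveI : Finite W.toAffine.Point := W.mordellWeilRank_eq_zero_iff_finite.mp hr
  have hbot : (W.sha ⊓ AddSubgroup.torsionBy W.galH1 (p : ℤ) : AddSubgroup W.galH1) = ⊥ :=
    AddSubgroup.eq_bot_of_card_eq _ h3
  have hprim := primaryComponent_sha_eq_bot_of_inf_torsionBy_eq_bot W p hbot
  rw [W.natCard_selmerGroupPInfty_eq_natCard_primaryComponent_sha p, hprim, AddSubgroup.card_bot]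

/-- **The unit road with the lane's descent line**: as
`mazurMainConjecture_three_of_ainvs_of_trivialArithmetic`, the Selmer binder being `#Sel^{(3)}(E/ℚ) = 1`
(a certified full `3`-descent: `dim Sel₃ = 0`) instead of `#Sel_{3^∞}(E/ℚ) = 1`. Per pair; nothing booked.
[cite: Kato2004Asterisque, Thm. 17.4 (1) (p. 273)] [cite: GreenbergLNM1716, Thm. 4.1 (p. 102) and Prop. 3.8 (p. 95)]
[cite: SilvermanAEC2009, Thm X.4.2] -/
theorem mazurMainConjecture_three_of_ainvs_of_trivialArithmetic_of_card_selmerThree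
    (hkato : ∀ (W : WeierstrassCurve ℚ) [W.IsElliptic] [W.IsGloballyMinimal] (p : ℕ) [Fact p.Prime]
      (κ : ZpExtension ℚ p) (γ : Field.absoluteGaloisGroup ℚ) (N : ℕ) [NeZero N]
      (f : CuspForm (Gamma0 N) 2), kato_divisibility W p (κ := κ) (γ := γ) (f := f))
    (hGr : greenberg_charValue_rankZero) (h5 : realPeriodRat_eq_unit_mul_plusPeriod)
    (h3 : realPeriodRat_eq_unit_mul_plusPeriod_three)
    (a1 a2 a3 a4 a6 : ℤ) {W : WeierstrassCurve ℚ} [W.IsElliptic] [W.IsGloballyMinimal]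
    (hW : integralModelInt W = ⟨a1, a2, a3, a4, a6⟩)
    [Fact (Nat.Prime 3)] (ℓ n n3 : ℕ) [Fact ℓ.Prime]
    (h3Δ : ¬ (3 : ℤ) ∣ discOf [a1, a2, a3, a4, a6])
    (hcard3 : Nat.card (((⟨a1, a2, a3, a4, a6⟩ : WeierstrassCurve ℤ).map
      (Int.castRingHom (ZMod 3))).toAffine.Point) = n3)
    (hord3 : ¬ (3 : ℤ) ∣ (3 : ℤ) + 1 - n3) (hna3 : ¬ 3 ∣ n3)
    (hℓ3 : ℓ ≠ 3) (hℓΔ : ¬ (ℓ : ℤ) ∣ discOf [a1, a2, a3, a4, a6])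
    (hcard : Nat.card (((⟨a1, a2, a3, a4, a6⟩ : WeierstrassCurve ℤ).map
      (Int.castRingHom (ZMod ℓ))).toAffine.Point) = n)
    (hnoroot : ∀ t : ℕ, t < 3 → ¬ (3 : ℤ) ∣ (t : ℤ) ^ 2 - ((ℓ : ℤ) + 1 - n) * t + ℓ)
    (htam : ¬ 3 ∣ W.tamagawaProduct)
    (hL : ∃ q : ℚ, q ≠ 0 ∧ W.entireLFunction 1 / (W.realPeriodRat : ℂ) = (q : ℂ) ∧ padicValRat 3 q = 0)
    (hSel3 : Nat.card (W.selmerGroup (3 : ℤ)) = 1) :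
    MazurMainConjecture W 3 :=
  mazurMainConjecture_three_of_ainvs_of_trivialArithmetic hkato hGr h5 h3 a1 a2 a3 a4 a6 hW ℓ n n3
    h3Δ hcard3 hord3 hna3 hℓ3 hℓΔ hcard hnoroot htam hL
    (natCard_selmerGroupPInfty_eq_one_of_natCard_selmerGroup_eq_one W 3 (by exact_mod_cast hSel3))

/-- **The trivial-partner road with the lane's descent line for the PARTNER**: as
`mazurMainConjecture_three_of_ainvs_of_trivialPartner`, with `hSelA3 : #Sel^{(3)}(A/ℚ) = 1`.
Per pair; nothing booked. [cite: GreenbergVatsal2000, Thm. (1.4) (arXiv p. 5)]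
[cite: Kato2004Asterisque, Thm. 17.4 (1) (p. 273)] [cite: SilvermanAEC2009, Thm X.4.2] -/
theorem mazurMainConjecture_three_of_ainvs_of_trivialPartner_of_card_selmerThree
    (hkato : ∀ (W : WeierstrassCurve ℚ) [W.IsElliptic] [W.IsGloballyMinimal] (p : ℕ) [Fact p.Prime]
      (κ : ZpExtension ℚ p) (γ : Field.absoluteGaloisGroup ℚ) (N : ℕ) [NeZero N]
      (f : CuspForm (Gamma0 N) 2), kato_divisibility W p (κ := κ) (γ := γ) (f := f))
    (hGr : greenberg_charValue_rankZero) (h5 : realPeriodRat_eq_unit_mul_plusPeriod)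
    (h3 : realPeriodRat_eq_unit_mul_plusPeriod_three)
    (hGV : GreenbergVatsal2000.thm14_mainConjecture_transfer_of_torsionIso)
    (a1 a2 a3 a4 a6 : ℤ) {W : WeierstrassCurve ℚ} [W.IsElliptic] [W.IsGloballyMinimal]
    (hW : integralModelInt W = ⟨a1, a2, a3, a4, a6⟩)
    (b1 b2 b3 b4 b6 : ℤ) {A : WeierstrassCurve ℚ} [A.IsElliptic] [A.IsGloballyMinimal]
    (hA : integralModelInt A = ⟨b1, b2, b3, b4, b6⟩)
    [Fact (Nat.Prime 3)] (ℓ n n3 m3 : ℕ) [Fact ℓ.Prime]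
    (h3Δ : ¬ (3 : ℤ) ∣ discOf [a1, a2, a3, a4, a6])
    (hcard3 : Nat.card (((⟨a1, a2, a3, a4, a6⟩ : WeierstrassCurve ℤ).map
      (Int.castRingHom (ZMod 3))).toAffine.Point) = n3)
    (hord3 : ¬ (3 : ℤ) ∣ (3 : ℤ) + 1 - n3)
    (hℓ3 : ℓ ≠ 3) (hℓΔ : ¬ (ℓ : ℤ) ∣ discOf [a1, a2, a3, a4, a6])
    (hcard : Nat.card (((⟨a1, a2, a3, a4, a6⟩ : WeierstrassCurve ℤ).map
      (Int.castRingHom (ZMod ℓ))).toAffine.Point) = n)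
    (hnoroot : ∀ t : ℕ, t < 3 → ¬ (3 : ℤ) ∣ (t : ℤ) ^ 2 - ((ℓ : ℤ) + 1 - n) * t + ℓ)
    (h3ΔA : ¬ (3 : ℤ) ∣ discOf [b1, b2, b3, b4, b6])
    (hcard3A : Nat.card (((⟨b1, b2, b3, b4, b6⟩ : WeierstrassCurve ℤ).map
      (Int.castRingHom (ZMod 3))).toAffine.Point) = m3)
    (hord3A : ¬ (3 : ℤ) ∣ (3 : ℤ) + 1 - m3) (hna3A : ¬ 3 ∣ m3)
    (htamA : ¬ 3 ∣ A.tamagawaProduct)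
    (hLA : ∃ q : ℚ, q ≠ 0 ∧ A.entireLFunction 1 / (A.realPeriodRat : ℂ) = (q : ℂ) ∧ padicValRat 3 q = 0)
    (hSelA3 : Nat.card (A.selmerGroup (3 : ℤ)) = 1)
    (hC1 : ∃ e : geomTorsion A ((3 : ℕ) : ℤ) ≃+ geomTorsion W ((3 : ℕ) : ℤ),
      ∀ (σ : Field.absoluteGaloisGroup ℚ) (P : geomTorsion A ((3 : ℕ) : ℤ)), e (σ • P) = σ • e P) :
    MazurMainConjecture W 3 :=
  mazurMainConjecture_three_of_ainvs_of_trivialPartner hkato hGr h5 h3 hGV a1 a2 a3 a4 a6 hW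
    b1 b2 b3 b4 b6 hA ℓ n n3 m3 h3Δ hcard3 hord3 hℓ3 hℓΔ hcard hnoroot h3ΔA hcard3A hord3A hna3A htamA hLA
    (natCard_selmerGroupPInfty_eq_one_of_natCard_selmerGroup_eq_one A 3 (by exact_mod_cast hSelA3)) hC1

end Summit.BirchSwinnertonDyer.Rank1Residual.X10.UnitRoad
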